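import Mathlib
import Summits.Ventures.HodgeRepro.Tier4.Target
import Summits.Ventures.HodgeRepro.Tier4.LitCompactness
import Summits.Ventures.HodgeRepro.Tier4.Line3.Defs
import Summits.Ventures.HodgeRepro.Tier4.Line3.LocaliserS
import Summits.Ventures.HodgeRepro.Tier4.Line3.BallCoordLemmas
import Summits.Ventures.HodgeRepro.Tier4.Line3.OffMainMassAssembly
import Summits.Ventures.HodgeRepro.Tier4.Line3.PointwiseOffMainBound
import Summits.Ventures.HodgeRepro.Tier4.Line3.SuppMajorantBound

/-!
# Tier4/Line3/OffMainBoundClosed — rung (A) of L3.5 CLOSED BY NAME on the localisers the line produces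

Blind re-derivation cell `pub-hodge-repro`, Tier 4 «PROVE THE STEP» (README §9–§10), LINE L3, seat t4-L2-p1 g2 (the
lineage on L3.5 with t4-L2-p3 / t4-x2).

(A) `PointwiseOffMainBound D p L₀ xm ℓ` — the off-main density `Σ′_{w off-main} ‖summand (loc N) w z‖ₑ` at `z ∈ 𝔹` is
`≤ K · e^{−κ q^{N/d}} / (1 − |z|²)^m` with `K, κ, m` independent of `N` — was landed by t4-L2-p1 g0 as a COMPOSITION
with the lattice Gaussian sum (R2) DISPLAYED (`pointwiseOffMainBound_of_suppMajorant_tsum_le`, PointwiseOffMainBound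
p673589).  (R2) is now IN THE TREE (t4-x2, `exists_suppMajorant_tsum_le`, SuppMajorantBound p674036): this module applies
the one to the other.  The class bound behind (A) (t4-L2-p3's `summand_bound_off_main_def`, ClassBoundDef) holds for the
SYMMETRIC main tuple `xm = (a, b, a, b)` with `a, b` independent — exactly the tuples `IsHeckeLocalisableP` / `loc_exists_of_pos`
deliver to the line (`xm 2 = xm 0`, `xm 3 = xm 1`, ball-coordinate wedge `≠ 0`); both the `LinearIndependent` and the
ball-wedge forms of the independence are provided (`linearIndependent_of_ballWedge`, BallCoordLemmas p666667).

With (A) a theorem, L3.5's conclusion (`term_dominated` of the line, v0.21–v0.33 statement) follows from the reduction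
`term_dominated_of_bounds` (OffMainMassAssembly p672713) with ONLY rung (B) `BoundedCosetReps` (the coset representatives
of `Γ/level N` with polynomially bounded inverses — the logarithmic-diameter consequence of property (τ), a PRINTED input)
and Borel–Harish-Chandra (`hlit`) displayed: `term_dominated_of_bcr` / `term_dominated_of_exists_bcr`.  The ∀-localiser
form `term_dominated_of_bcrAll` takes (B) quantified over every localiser, the shape of the skeleton's `BoundedCosetRepsAll`.

Nothing here asserts anything about the truth of (P); HC_CM is NOT proved by anyone in this repository.
-/

set_option autoImplicit false

noncomputable section

namespace Summit.Ventures.HodgeRepro.Tier4.Line3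

open Summit.Ventures.HodgeRepro.Tier4
open Matrix NumberField

namespace T4Data

variable (X : T4Data)

/-- **RUNG (A) OF L3.5, CLOSED — `LinearIndependent` form.** For a localiser `ℓ : LocS D p L₀ xm` of a symmetric main tuple
with independent `xm 0, xm 1`, the off-main density is bounded by `K · e^{−κ q^{N/d}} / (1 − |z|²)^m` on the ball, uniformly
in the depth: the class bound with the definite Gaussians (`summand_bound_off_main_def`) composed with the lattice
Gaussian sum over the support (`exists_suppMajorant_tsum_le`), through `pointwiseOffMainBound_of_suppMajorant_tsum_le`. -/
theorem pointwiseOffMainBound_of_linearIndependent (D : X.ThetaData)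
    {p : IsDedekindDomain.HeightOneSpectrum (RingOfIntegers X.E)}
    {L₀ : Submodule (RingOfIntegers X.E) (Fin 3 → X.E)} {xm : X.Tuple}
    (h02 : xm 2 = xm 0) (h13 : xm 3 = xm 1) (hab : LinearIndependent X.E ![xm 0, xm 1])
    (ℓ : X.LocS D p L₀ xm) :
    X.PointwiseOffMainBound D p L₀ xm ℓ :=
  X.pointwiseOffMainBound_of_suppMajorant_tsum_le D h02 h13 hab ℓ
    (fun c₁ e hc₁ => X.exists_suppMajorant_tsum_le D p L₀ xm ℓ c₁ e hc₁)

/-- **RUNG (A) OF L3.5, CLOSED — ball-wedge form** (the independence clause as `IsHeckeLocalisableP` / `loc_exists_of_pos`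
state it: `ballCoord (xm 0) 0 * ballCoord (xm 1) 1 - ballCoord (xm 0) 1 * ballCoord (xm 1) 0 ≠ 0`), via
`linearIndependent_of_ballWedge`. -/
theorem pointwiseOffMainBound_of_ballWedge (D : X.ThetaData)
    {p : IsDedekindDomain.HeightOneSpectrum (RingOfIntegers X.E)}
    {L₀ : Submodule (RingOfIntegers X.E) (Fin 3 → X.E)} {xm : X.Tuple}
    (h02 : xm 2 = xm 0) (h13 : xm 3 = xm 1)
    (hab : X.ballCoord (xm 0) 0 * X.ballCoord (xm 1) 1 - X.ballCoord (xm 0) 1 * X.ballCoord (xm 1) 0 ≠ 0)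
    (ℓ : X.LocS D p L₀ xm) :
    X.PointwiseOffMainBound D p L₀ xm ℓ :=
  X.pointwiseOffMainBound_of_linearIndependent D h02 h13 (X.linearIndependent_of_ballWedge hab) ℓ

/-- **L3.5 FROM RUNG (B) AND BOREL–HARISH-CHANDRA ALONE** (the line's `term_dominated` statement, v0.21–v0.33): with (A) a
theorem, the reduction `term_dominated_of_bounds` leaves exactly `BoundedCosetReps` (printed: property (τ) for the
congruence covers) and `hlit` displayed. -/
theorem term_dominated_of_bcr (D : X.ThetaData)
    (hlit : Lit.BorelHarishChandra1962_Thm11_8_fundamentalDomain_hdef X.E X.H X.τ₀ X.C)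
    {p : IsDedekindDomain.HeightOneSpectrum (RingOfIntegers X.E)}
    {L₀ : Submodule (RingOfIntegers X.E) (Fin 3 → X.E)} {xm : X.Tuple}
    (h02 : xm 2 = xm 0) (h13 : xm 3 = xm 1)
    (hab : X.ballCoord (xm 0) 0 * X.ballCoord (xm 1) 1 - X.ballCoord (xm 0) 1 * X.ballCoord (xm 1) 0 ≠ 0)
    (ℓ : X.LocS D p L₀ xm) {q₀ : ℕ} (hq₀ : 1 ≤ q₀) (hR : X.BoundedCosetReps D p L₀ xm ℓ q₀) :
    ∃ bound : X.Orbit → ℝ, (∀ o, 0 ≤ bound o) ∧ Summable bound ∧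
      ∀ N (o : X.Orbit), o ≠ X.orbitOf (X.lines xm) → ‖X.term D.Φ D.cf (ℓ.level N) (ℓ.loc N) o‖ ≤ bound o :=
  X.term_dominated_of_bounds D ℓ hq₀ (X.pointwiseOffMainBound_of_ballWedge D h02 h13 hab ℓ) hR hlit

/-- `term_dominated_of_bcr` with the modulus `q₀` existential (the per-localiser shape of the skeleton's
`BoundedCosetRepsAll`). -/
theorem term_dominated_of_exists_bcr (D : X.ThetaData)
    (hlit : Lit.BorelHarishChandra1962_Thm11_8_fundamentalDomain_hdef X.E X.H X.τ₀ X.C)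
    {p : IsDedekindDomain.HeightOneSpectrum (RingOfIntegers X.E)}
    {L₀ : Submodule (RingOfIntegers X.E) (Fin 3 → X.E)} {xm : X.Tuple}
    (h02 : xm 2 = xm 0) (h13 : xm 3 = xm 1)
    (hab : X.ballCoord (xm 0) 0 * X.ballCoord (xm 1) 1 - X.ballCoord (xm 0) 1 * X.ballCoord (xm 1) 0 ≠ 0)
    (ℓ : X.LocS D p L₀ xm) (hR : ∃ q₀ : ℕ, 1 ≤ q₀ ∧ X.BoundedCosetReps D p L₀ xm ℓ q₀) :
    ∃ bound : X.Orbit → ℝ, (∀ o, 0 ≤ bound o) ∧ Summable bound ∧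
      ∀ N (o : X.Orbit), o ≠ X.orbitOf (X.lines xm) → ‖X.term D.Φ D.cf (ℓ.level N) (ℓ.loc N) o‖ ≤ bound o := by
  obtain ⟨q₀, hq₀, hRℓ⟩ := hR
  exact X.term_dominated_of_bcr D hlit h02 h13 hab ℓ hq₀ hRℓ

/-- **THE SKELETON'S `term_dominated_of_rungs` WITH `hA` DISCHARGED**: rung (B) quantified over every localiser (the
definiens of the skeleton's `BoundedCosetRepsAll D`, stated inline — skeleton files are not in the tree), (A) a theorem. -/
theorem term_dominated_of_bcrAll (D : X.ThetaData)
    (hlit : Lit.BorelHarishChandra1962_Thm11_8_fundamentalDomain_hdef X.E X.H X.τ₀ X.C)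
    (hR : ∀ (p : IsDedekindDomain.HeightOneSpectrum (RingOfIntegers X.E))
      (L₀ : Submodule (RingOfIntegers X.E) (Fin 3 → X.E)) (xm : X.Tuple) (ℓ : X.LocS D p L₀ xm),
      ∃ q₀ : ℕ, 1 ≤ q₀ ∧ X.BoundedCosetReps D p L₀ xm ℓ q₀)
    {p : IsDedekindDomain.HeightOneSpectrum (RingOfIntegers X.E)}
    {L₀ : Submodule (RingOfIntegers X.E) (Fin 3 → X.E)} {xm : X.Tuple}
    (h02 : xm 2 = xm 0) (h13 : xm 3 = xm 1)
    (hab : X.ballCoord (xm 0) 0 * X.ballCoord (xm 1) 1 - X.ballCoord (xm 0) 1 * X.ballCoord (xm 1) 0 ≠ 0)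
    (ℓ : X.LocS D p L₀ xm) :
    ∃ bound : X.Orbit → ℝ, (∀ o, 0 ≤ bound o) ∧ Summable bound ∧
      ∀ N (o : X.Orbit), o ≠ X.orbitOf (X.lines xm) → ‖X.term D.Φ D.cf (ℓ.level N) (ℓ.loc N) o‖ ≤ bound o :=
  X.term_dominated_of_exists_bcr D hlit h02 h13 hab ℓ (hR p L₀ xm ℓ)

end T4Data

end Summit.Ventures.HodgeRepro.Tier4.Line3

end
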